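/-
Copyright (c) 2026 the pub-hodgecm-mathlib formalisation cell (harness21).  Prover seat hodgecm-mathlib-A-p03 (g23), P2 road «(C♯)hol»,
brick (E3-i) (desk F0P2-plan (g9) 2026-08-31T23:49:15Z).  KERNEL: one theorem, Lines-free.
-/
import Literature.NumberTheory.Rogawski1990.CohomologicalFinComponentIsThetaSigned
import Literature.NumberTheory.Automorphic.Liu2021.CohHolMeetsThetaLiftFromLine
import Literature.NumberTheory.Automorphic.Liu2021.ThetaLiftFromLineFinComponent
import Literature.NumberTheory.Automorphic.Liu2021.ThetaLiftFromLineArchAssembly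
import Literature.NumberTheory.Automorphic.Liu2021.ThetaLiftFromLineFrame
import HarnessLib

/-!
# Letter #87 (C♯)hol from the four interior letters D1, B, C∞, Cc — the Lines-free composition `cSharpHol_of_letters`
([Liu2021] proof of Prop. 4.13, Case 1 (pp. 47–48); App. D Lem. D.2 (p. 127); [Rogawski1990] §13.3, Thm. 13.3.6 (c))

Topic `Summits/HodgeConjecture` (programme P2, road «(C♯)hol», brick (E3-i)); namespace
`Summit.HodgeConjecture.HodgeConjecture.Cruxes.H413.F0P2oCSharpHolOfLetters`.  KERNEL ONLY: one proved theorem; 0 definitions, 0 instances, 0 `sorry`;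
imports Literature ONLY (no `Cruxes/…/Lines`, no `Theorems/`), so that BOTH registered consumers — the T5a line `Cruxes/H413/Lines/F0_P2CSharpHolThetaLine.lean`
(its `cSharpHol_of_stubs`, of which this is the VERBATIM Lines-free copy) and the E3 line `Cruxes/H413/Lines/F0_P2E3Rung3.lean` (`stub_CSharp_letter`, fold
«C♯ DERIVE» v1.3) — can close #87 BY NAME over the same two open letters {D1, C∞} without a Lines → Lines import (F0P2-ref1 O50-1; desk F0P2-plan (g9)
2026-08-31T23:49:15Z (E3-i)).

`cSharpHol_of_letters (hD1) (hB) (hCi) (hCc) : Rogawski1990.cohFinComponent_isThetaSigned_hol` — theta exhaustion (D1 = ★ named fact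
`Liu2021.cohHol_meetsThetaLiftFromLine`, [Liu2021 Prop. 4.13 ∕ Thm. B.4–Cor. B.6]), the finite local–global node (B = ★ `Liu2021.meetsThetaLiftFromLine_hasFinComponent_rhoAtLine`,
PROVED in the tree: ★ `F0P2NodeBFinComponentHolds`), and the two applied clauses of the archimedean Weil dictionary (C∞ = ★ `Liu2021.meetsThetaLiftFromLine_hol_archTypeAt`,
Cc = ★ `Liu2021.meetsThetaLiftFromLine_hol_archTypeAway`, the latter PROVED: ★ `F0P2oCcArchTypeAwayHolds`) give print letter #87 verbatim, through the tree theorems ★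
`Liu2021.hasWeightOne_admissible_of_archTypes` (node C) and ★ `Liu2021.adelicFrameCompact` (frame ∕ compactness supply).  The hypotheses are the four Literature
named facts BY NAME; consumers discharge B and Cc by the two ★ `_holds` theorems and keep D1, C∞ as their registered stubs.

HONEST SCOPE.  A composition, no new mathematics; #87 becomes CLOSED-DERIVED from {D1, C∞} only when a registered consumer folds over this theorem.  HC_CM is
NOT proved here or anywhere in the tree — it stays conditional on the remaining named inputs (hLiu418, h413) until rung 0 closes.

References: [Liu2021] Y. Liu, *Arithmetic theta lifting and L-derivatives for unitary groups*, proof of Prop. 4.13 Case 1 (l. 2129–2141, pp. 47–48), App. D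
Lem. D.2 p. 127; [Rogawski1990] J. D. Rogawski, *Automorphic Representations of Unitary Groups in Three Variables* (1990), §13.3 Thm. 13.3.6 (c);
[GelbartRogawski1991] S. Gelbart, J. Rogawski, *L-functions and Fourier–Jacobi coefficients for the unitary group U(3)*, Invent. Math. 105 (1991), Thm. 5.1.1.
-/

set_option autoImplicit false
set_option linter.dupNamespace false

noncomputable section

namespace Summit.HodgeConjecture.HodgeConjecture.Cruxes.H413.F0P2oCSharpHolOfLetters

set_option synthInstance.maxHeartbeats 400000 in
set_option maxHeartbeats 8000000 in
/-- **LETTER #87 (C♯)hol FROM THE FOUR INTERIOR LETTERS**: theta exhaustion (D1), the finite local–global node (B), the two applied clauses of the archimedean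
Weil dictionary (C∞, Cc; node C by the tree theorem ★ `hasWeightOne_admissible_of_archTypes`) and the frame∕compactness supply (★ `adelicFrameCompact`) give print
letter #87 (C♯)hol verbatim — the Lines-free copy of T5a's `cSharpHol_of_stubs`.
[cite: Liu2021, Prop. 4.13 proof Case 1 (l. 2129–2141, pp. 47–48); Lem. D.2 p. 127] [cite: Rogawski1990, §13.3 Thm. 13.3.6 (c)] -/
theorem cSharpHol_of_letters (hD1 : Literature.NumberTheory.Automorphic.Liu2021.cohHol_meetsThetaLiftFromLine)
    (hB : Literature.NumberTheory.Automorphic.Liu2021.meetsThetaLiftFromLine_hasFinComponent_rhoAtLine)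
    (hCi : Literature.NumberTheory.Automorphic.Liu2021.meetsThetaLiftFromLine_hol_archTypeAt)
    (hCc : Literature.NumberTheory.Automorphic.Liu2021.meetsThetaLiftFromLine_hol_archTypeAway) :
    Literature.NumberTheory.Rogawski1990.cohFinComponent_isThetaSigned_hol := by
  have hF := Literature.NumberTheory.Automorphic.Liu2021.adelicFrameCompact
  have hC : Literature.NumberTheory.Automorphic.Liu2021.meetsThetaLiftFromLine_hol_hasWeightOne_admissible :=
    Literature.NumberTheory.Automorphic.Liu2021.hasWeightOne_admissible_of_archTypes hCi hCc
  intro L _ _ _ ι H T hT hdef hd n' e₁ dV hdV hdV0 g hg ιV hιV μA _ P hP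
  obtain ⟨ιA, hιA, hcpt⟩ := hF L ι H hdef hd dV hdV hdV0 g hg
  haveI := hcpt
  obtain ⟨μ, hμ, a, hmeet⟩ := hD1 L ι H T hT hdef hd e₁ dV hdV hdV0 g hg ιA hιA μA P hP
  obtain ⟨χ, hfin⟩ := hB L ι H T hT hdef hd e₁ dV hdV hdV0 g hg ιV hιV ιA hιA μA P μ hμ a hmeet hP
  obtain ⟨hw, hadm⟩ := hC L ι H T hT hdef hd e₁ dV hdV hdV0 g hg ιA hιA μA P μ hμ a hmeet hP
  exact ⟨μ, hμ, hw, a, χ, hadm, hfin⟩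

end Summit.HodgeConjecture.HodgeConjecture.Cruxes.H413.F0P2oCSharpHolOfLetters

end
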